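import Mathlib
import Literature.Computability.AlgebraicComplexity.PermanentIrreducible
import Literature.Computability.AlgebraicComplexity.StandardFamiliesProofs

/-!
# Crux `DivisionGap.PerCofactorDegreeReduction` (stmt-ValiantsHypothesis-15046), line `Sketch` —
# stub `stub_parametrizedRelations`: the relations of parametrised gates modulo the permanent are
# exactly the identities of the parametrisation

**Theorem (`stub_parametrizedRelations`).** Let `A, B ∈ ℝ[x_ij]` (`n × n` variables) be
algebraically independent modulo `per_n`, i.e. `per_n ∣ R(A, B)` forces `R = 0` for every
`R ∈ ℝ[y₀, y₁]`.  Let `P₀, …, P_{r-1} ∈ ℝ[y₀, y₁]` and `U₀, …, U_{r-1} ∈ ℝ[x_ij]` with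
`U_j ≡ P_j(A, B) (mod per_n)`.  Then for every `G ∈ ℝ[z₀, …, z_{r-1}]`:
`per_n ∣ G(U) ⟺ G(P₀, …, P_{r-1}) = 0` in `ℝ[y₀, y₁]`.

## Proof

Work in the quotient `ℝ`-algebra `Q := ℝ[x_ij] ⧸ (per_n)` with quotient map `π`.  Since `π` is an
`ℝ`-algebra map, `π (G(U)) = G(π U₀, …, π U_{r-1})` and likewise
`π (G(P(A,B))) = G(π P₀(A,B), …)`; the classes `π U_j = π P_j(A,B)` agree by hypothesis, so
`G(U) ≡ G(P(A,B)) (mod per_n)`.  Moreover `G(P(A,B)) = (G ∘ P)(A,B)` (substitution is an algebra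
map, `MvPolynomial.comp_aeval`).  Hence `per_n ∣ G(U) ⟺ per_n ∣ (G∘P)(A,B)`, and by independence
the latter holds iff `G ∘ P = 0` (the converse direction being trivial: `(0)(A,B) = 0`).
-/

noncomputable section

-- `Summit.ValiantsHypothesis.ValiantsHypothesis.…` is the tree's mandated single-conjunct layout
-- (Problem = Summit), so the duplicated namespace component is intended.
set_option linter.dupNamespace false

namespace Summit.ValiantsHypothesis.ValiantsHypothesis.Theorems.DivisionGap.PerCofactorDegreeReduction.ParametrizedRelations

open MvPolynomial Literature.Computability.AlgebraicComplexity
open scoped NNReal BigOperators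

/-- Substitution respects congruences: if `f i ≡ g i (mod q)` for all `i`, then
`G(f) ≡ G(g) (mod q)` for every polynomial `G` (the quotient map by `(q)` is an algebra map and
`MvPolynomial.aeval` into the quotient only sees the classes of the `f i`). [folklore] -/
theorem dvd_aeval_sub_aeval {σ R S : Type*} [CommRing R] [CommRing S] [Algebra R S]
    (q : S) (f g : σ → S) (h : ∀ i, q ∣ f i - g i) (G : MvPolynomial σ R) :
    q ∣ MvPolynomial.aeval f G - MvPolynomial.aeval g G := by
  rw [← Ideal.mem_span_singleton, ← Ideal.Quotient.eq]
  change Ideal.Quotient.mkₐ R (Ideal.span {q}) (aeval f G) =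
    Ideal.Quotient.mkₐ R (Ideal.span {q}) (aeval g G)
  rw [comp_aeval_apply f, comp_aeval_apply g]
  congr 2
  funext i
  exact Ideal.Quotient.eq.mpr (Ideal.mem_span_singleton.mpr (h i))

/-- **stub_parametrizedRelations — RELATIONS OF PARAMETRISED GATES ARE THE IDENTITIES OF THE
PARAMETRISATION.**  If the real polynomials `A, B` are algebraically independent modulo `per_n`
and `U_j ≡ P_j(A, B) (mod per_n)` for binary polynomials `P_j`, then for every real `G`:
`per_n ∣ G(U) ⟺ G(P₀, …, P_{r−1}) = 0` in `ℝ[a,b]`.  Proof: modulo `per_n`,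
`G(U) ≡ G(P(A,B)) = (G∘P)(A,B)` (`dvd_aeval_sub_aeval`, `MvPolynomial.comp_aeval`), and
`(G∘P)(A,B) ∈ (per_n) ⟺ G∘P = 0` by independence. [folklore] -/
theorem stub_parametrizedRelations (n r : ℕ) (A B : MvPolynomial (Fin n × Fin n) ℝ)
    (hind : ∀ R : MvPolynomial (Fin 2) ℝ, perPoly (Fin n) ℝ ∣ MvPolynomial.aeval ![A, B] R → R = 0)
    (P : Fin r → MvPolynomial (Fin 2) ℝ) (U : Fin r → MvPolynomial (Fin n × Fin n) ℝ)
    (hU : ∀ j, perPoly (Fin n) ℝ ∣ U j - MvPolynomial.aeval ![A, B] (P j))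
    (G : MvPolynomial (Fin r) ℝ) :
    perPoly (Fin n) ℝ ∣ MvPolynomial.aeval U G ↔ MvPolynomial.aeval P G = 0 := by
  -- `G(P(A,B)) = (G ∘ P)(A,B)`.
  have hcomp : aeval (fun j => aeval ![A, B] (P j)) G = aeval ![A, B] (aeval P G) :=
    (comp_aeval_apply P (aeval ![A, B]) G).symm
  -- `G(U) ≡ (G ∘ P)(A,B) (mod per_n)`.
  have hcong : perPoly (Fin n) ℝ ∣ aeval U G - aeval ![A, B] (aeval P G) :=
    hcomp ▸ dvd_aeval_sub_aeval (perPoly (Fin n) ℝ) U (fun j => aeval ![A, B] (P j)) hU G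
  constructor
  · intro hdvd
    refine hind _ ?_
    have := dvd_sub hdvd hcong
    rwa [sub_sub_cancel] at this
  · intro hG
    have := hcong
    rwa [hG, map_zero, sub_zero] at this

end Summit.ValiantsHypothesis.ValiantsHypothesis.Theorems.DivisionGap.PerCofactorDegreeReduction.ParametrizedRelations
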